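import Mathlib
import HarnessLib
import HarnessLib.Audit

/-!
# ValiantsHypothesis / LacunarySymmetroid — crux `MatrixDescartes` (stmt-ValiantsHypothesis-18050, V1), LINE (A) «product_plus_one»:
# localized ZERO-ONCE lemmas (kit for THEOREM C `IdenticalRowsAtMostThree` and for sign-change counting of the rate function `J`)

✓ `zero_once_of_deriv_neg` (`…SmallRatioLemmas`) is global on `(0,∞)`; the sign analysis of the rate function `J` of ✓ `…MultiplierQuotient`
beyond ratio `2` (pen val-idea-25 g9 T3♯ / Theorem C: at a zero of `J` the sign of `θJ` is that of a monotone threshold function, so zeros are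
up-crossings on an initial segment and down-crossings afterwards) needs the LOCAL forms:
* `zero_once_local_of_deriv_neg` — `0 < x < y`, `f x = f y = 0` and every zero of `f` in `[x,y]` a strict down-crossing ⇒ `False`;
* `zero_once_local_of_deriv_pos` — the same with strict up-crossings;
* `rowRate_strictMono` — the rate `θP/P` of a zero-change trinomial row `p + qX^a + sX^c` (`p, s > 0 ≤ q`) is strictly increasing.
HONEST FRAMING: generic real-analysis helpers; nothing about a stub; `OneChangeFloorK3`, `MatrixDescartes` OPEN; `VP ≠ VNP` NOT proved.
No definitions, no named facts, no sorry.
-/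

set_option linter.dupNamespace false

namespace Summit.ValiantsHypothesis.ValiantsHypothesis.Theorems.LacunarySymmetroidMatrixDescartes

namespace ZeroChange

open Set Filter Topology

/-- The rate of a zero-change trinomial row with `p, s > 0 ≤ q` is strictly increasing on `(0,∞)`. -/
theorem rowRate_strictMono {a c : ℕ} (ha : 0 < a) (hac : a < c) {p q s : ℝ} (hp : 0 < p) (hq : 0 ≤ q) (hs : 0 < s)
    {t t' : ℝ} (ht : 0 < t) (htt : t < t') :
    ((a : ℝ) * q * t ^ a + (c : ℝ) * s * t ^ c) / (p + q * t ^ a + s * t ^ c)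
      < ((a : ℝ) * q * t' ^ a + (c : ℝ) * s * t' ^ c) / (p + q * t' ^ a + s * t' ^ c) := by
  have ht' : 0 < t' := ht.trans htt
  have ha' : (0 : ℝ) < a := by exact_mod_cast ha
  have hc' : (0 : ℝ) < c := by exact_mod_cast (ha.trans hac)
  have hca : (0 : ℝ) < (c : ℝ) - a := by
    have : (a : ℝ) < c := by exact_mod_cast hac
    linarith
  have hden : ∀ u : ℝ, 0 < u → 0 < p + q * u ^ a + s * u ^ c := fun u hu => by positivity
  obtain ⟨d, hd⟩ : ∃ d, c = a + d := ⟨c - a, by omega⟩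
  have key : t ^ c * t' ^ a ≤ t ^ a * t' ^ c := by
    rw [hd, pow_add, pow_add]
    have h1 : t ^ d ≤ t' ^ d := pow_le_pow_left₀ ht.le htt.le d
    have h2 : 0 ≤ t ^ a * t' ^ a := by positivity
    nlinarith [mul_le_mul_of_nonneg_left h1 h2]
  have hpa : t ^ a < t' ^ a := pow_lt_pow_left₀ htt ht.le ha.ne'
  have hpc : t ^ c < t' ^ c := pow_lt_pow_left₀ htt ht.le (ha.trans hac).ne'
  rw [div_lt_div_iff₀ (hden t ht) (hden t' ht')]
  nlinarith [mul_le_mul_of_nonneg_left key (by positivity : 0 ≤ q * s * ((c : ℝ) - a)),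
    mul_lt_mul_of_pos_left hpc (by positivity : 0 < (c : ℝ) * p * s),
    mul_le_mul_of_nonneg_left hpa.le (by positivity : 0 ≤ (a : ℝ) * p * q)]


/-- **Localized zero-once lemma**: a function differentiable on `(0,∞)` whose zeros in `[x,y]` are all strict down-crossings cannot vanish
at both `x` and `y` (`0 < x < y`). -/
theorem zero_once_local_of_deriv_neg {f f' : ℝ → ℝ} (hf : ∀ x, 0 < x → HasDerivAt f (f' x) x)
    {x y : ℝ} (hx : 0 < x) (hxy : x < y) (hfx : f x = 0) (hfy : f y = 0)
    (hneg : ∀ z, x ≤ z → z ≤ y → f z = 0 → f' z < 0) : False := by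
  -- right of a zero the function is negative for a while, left of a zero it is positive for a while
  have hright : ∀ z, 0 < z → f z = 0 → f' z < 0 → ∃ δ > 0, ∀ w, z < w → w < z + δ → f w < 0 := by
    intro z hz hfz hf'z
    have ht := (hf z hz).tendsto_slope_zero_right
    have hev : ∀ᶠ t in 𝓝[>] (0 : ℝ), t⁻¹ • (f (z + t) - f z) < 0 := ht.eventually_lt_const hf'z
    obtain ⟨u, hu, hsub⟩ := mem_nhdsGT_iff_exists_Ioo_subset.1 hev
    refine ⟨u, hu, fun w hzw hwz => ?_⟩
    have hmem : w - z ∈ Ioo (0 : ℝ) u := ⟨by linarith, by linarith⟩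
    have h1 := hsub hmem
    simp only [Set.mem_setOf_eq, hfz, sub_zero, smul_eq_mul, add_sub_cancel] at h1
    have hwz' : 0 < w - z := by linarith
    by_contra hge
    push Not at hge
    have : 0 ≤ (w - z)⁻¹ * f w := mul_nonneg (inv_nonneg.2 hwz'.le) hge
    linarith
  have hleft : ∀ z, 0 < z → f z = 0 → f' z < 0 → ∃ δ > 0, ∀ w, z - δ < w → w < z → 0 < f w := by
    intro z hz hfz hf'z
    have ht := (hf z hz).tendsto_slope_zero_left
    have hev : ∀ᶠ t in 𝓝[<] (0 : ℝ), t⁻¹ • (f (z + t) - f z) < 0 := ht.eventually_lt_const hf'z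
    obtain ⟨u, hu, hsub⟩ := mem_nhdsLT_iff_exists_Ioo_subset.1 hev
    refine ⟨-u, by simpa using hu, fun w hzw hwz => ?_⟩
    have hmem : w - z ∈ Ioo u (0 : ℝ) := ⟨by linarith, by linarith⟩
    have h1 := hsub hmem
    simp only [Set.mem_setOf_eq, hfz, sub_zero, smul_eq_mul, add_sub_cancel] at h1
    have hwz' : w - z < 0 := by linarith
    by_contra hle
    push Not at hle
    have : 0 ≤ (w - z)⁻¹ * f w := mul_nonneg_of_nonpos_of_nonpos (inv_nonpos.2 hwz'.le) hle
    linarith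
  -- continuity on `(0,∞)`
  have hcont : ∀ z, 0 < z → ContinuousAt f z := fun z hz => (hf z hz).continuousAt
  obtain ⟨δ, hδ, hδneg⟩ := hright x hx hfx (hneg x le_rfl hxy.le hfx)
  -- the first zero after `x`
  set x₁ := x + min (δ / 2) ((y - x) / 2) with hx₁
  have hx₁x : x < x₁ := by
    have : 0 < min (δ / 2) ((y - x) / 2) := lt_min (by linarith) (by linarith)
    linarith
  have hx₁y : x₁ ≤ y := by
    have : min (δ / 2) ((y - x) / 2) ≤ (y - x) / 2 := min_le_right _ _
    linarith
  have hx₁δ : x₁ < x + δ := by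
    have : min (δ / 2) ((y - x) / 2) ≤ δ / 2 := min_le_left _ _
    linarith
  set S : Set ℝ := Icc x₁ y ∩ f ⁻¹' {0} with hS
  have hSclosed : IsClosed S := by
    have hc : ContinuousOn f (Icc x₁ y) := fun z hz =>
      (hcont z (hx.trans (hx₁x.trans_le hz.1))).continuousWithinAt
    exact hc.preimage_isClosed_of_isClosed isClosed_Icc isClosed_singleton
  have hyS : y ∈ S := ⟨⟨hx₁y, le_rfl⟩, hfy⟩
  have hSne : S.Nonempty := ⟨y, hyS⟩
  have hSbdd : BddBelow S := ⟨x₁, fun z hz => hz.1.1⟩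
  set z₀ := sInf S with hz₀
  have hz₀S : z₀ ∈ S := hSclosed.csInf_mem hSne hSbdd
  have hz₀x₁ : x₁ ≤ z₀ := hz₀S.1.1
  have hfz₀ : f z₀ = 0 := hz₀S.2
  have hz₀pos : 0 < z₀ := hx.trans (hx₁x.trans_le hz₀x₁)
  -- `f < 0` on `(x, z₀)`
  have hnoroot : ∀ w, x < w → w < z₀ → f w ≠ 0 := by
    intro w hxw hwz hfw
    rcases lt_or_ge w x₁ with h1 | h1
    · exact (hδneg w hxw (h1.trans hx₁δ)).ne hfw
    · have hwS : w ∈ S := ⟨⟨h1, hwz.le.trans hz₀S.1.2⟩, hfw⟩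
      have := csInf_le hSbdd hwS
      linarith
  have hnegint : ∀ w, x < w → w < z₀ → f w < 0 := by
    intro w hxw hwz
    rcases lt_or_ge w (x + δ) with h1 | h1
    · exact hδneg w hxw h1
    · -- compare with the negative point `x₁' := (x + x₁)/2`… use the point `x₁` itself, which is `< x + δ`
      have hfx₁ : f x₁ < 0 := hδneg x₁ hx₁x hx₁δ
      by_contra hge
      push Not at hge
      rcases hge.eq_or_lt with h2 | h2
      · exact hnoroot w hxw hwz h2.symm
      · -- intermediate value on `[x₁, w]`
        have hcw : ContinuousOn f (Icc x₁ w) := fun z hz =>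
          (hcont z (hx.trans (hx₁x.trans_le hz.1))).continuousWithinAt
        have hx₁w : x₁ ≤ w := by linarith
        obtain ⟨r, hr, hfr⟩ := intermediate_value_Icc hx₁w hcw ⟨hfx₁.le, h2.le⟩
        rcases hr.1.eq_or_lt with h3 | h3
        · rw [← h3] at hfr; exact hfx₁.ne hfr
        · exact hnoroot r (hx₁x.trans h3) (hr.2.trans_lt hwz) hfr
  -- but left of the zero `z₀` the function is positive: contradiction
  obtain ⟨δ', hδ', hδ'pos⟩ := hleft z₀ hz₀pos hfz₀ (hneg z₀ (hx₁x.le.trans hz₀x₁) hz₀S.1.2 hfz₀)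
  set w := z₀ - min (δ' / 2) ((z₀ - x) / 2) with hw
  have hm : 0 < min (δ' / 2) ((z₀ - x) / 2) := lt_min (by linarith) (by linarith [hx₁x.trans_le hz₀x₁])
  have hw1 : z₀ - δ' < w := by
    have : min (δ' / 2) ((z₀ - x) / 2) ≤ δ' / 2 := min_le_left _ _
    linarith
  have hw2 : w < z₀ := by linarith
  have hw3 : x < w := by
    have : min (δ' / 2) ((z₀ - x) / 2) ≤ (z₀ - x) / 2 := min_le_right _ _
    linarith [hx₁x.trans_le hz₀x₁]
  exact absurd (hδ'pos w hw1 hw2) (not_lt.2 (hnegint w hw3 hw2).le)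


/-- **Localized zero-once lemma, up-crossing form**: zeros in `[x,y]` all strict up-crossings ⇒ `f` cannot vanish at both ends. -/
theorem zero_once_local_of_deriv_pos {f f' : ℝ → ℝ} (hf : ∀ x, 0 < x → HasDerivAt f (f' x) x)
    {x y : ℝ} (hx : 0 < x) (hxy : x < y) (hfx : f x = 0) (hfy : f y = 0)
    (hpos : ∀ z, x ≤ z → z ≤ y → f z = 0 → 0 < f' z) : False :=
  zero_once_local_of_deriv_neg (f := fun z => -f z) (f' := fun z => -f' z) (fun z hz => (hf z hz).neg) hx hxy
    (by simp [hfx]) (by simp [hfy]) (fun z h1 h2 h3 => by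
      have h3' : f z = 0 := by simpa using h3
      have := hpos z h1 h2 h3'
      linarith)

end ZeroChange

end Summit.ValiantsHypothesis.ValiantsHypothesis.Theorems.LacunarySymmetroidMatrixDescartes
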